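import Literature.NumberTheory.EllipticCurves.KodairaNeronSplitHenselianProofs
import Literature.NumberTheory.EllipticCurves.TamagawaRingEquivProofs
import Literature.NumberTheory.EllipticCurves.PAdicHeights
import Mathlib.NumberTheory.Padics.HeightOneSpectrum
import HarnessLib

/-!
# The Tate normal form of an elliptic curve over `ℚ` with split multiplicative reduction at `p`,
# over the completion `𝓞_v ⊆ ℚ_v` of the tree, with exponent the local Tamagawa number

`Proofs` file (theorems only, no definitions, no named facts) in topic
`NumberTheory/EllipticCurves`, a bottom-up step of the discharge of
`Literature.Barriers.BirchSwinnertonDyer.Matsuno2009_lemma41_local` (Matsuno 2009, Lemma 4.1),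
whose hypotheses "(i) `E` has split multiplicative reduction at `ℓ`" and "(iii) `n ∣ c_ℓ`" are
spelled with Mathlib's `ℚ_[ℓ]`, `ℤ_[ℓ]` (`WeierstrassCurve.HasSplitMultiplicativeReductionAtPrime`,
`PAdicHeights`; `WeierstrassCurve.localTamagawaNumber ℤ_[ℓ]`, `Tamagawa`), while its conclusion
lives over the tree's completion `ℚ_v = v.adicCompletion ℚ`, `v = primePlace ℓ`, where the local
Galois machinery is.  This file moves the curve across:

* `WeierstrassCurve.exists_tateNormalForm_padic` — over `ℤ_[p]`: the `ℤ_[p]`-minimal model of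
  `E ⊗ ℚ_[p]` with split multiplicative reduction is `ℚ_[p]`-isomorphic to a Tate normal form
  `J : y² + xy = x³ + απᶜ` (`α ∈ ℤ_[p]ˣ`, `π` a uniformiser) with **`c = c_p(E)`, the local
  Tamagawa number** (`[E(ℚ_p) : E₀(ℚ_p)] = c = v(Δ)`: Silverman, *ATAEC*, Cor. IV.9.2(d); tree:
  `WeierstrassCurve.exists_variableChange_eq_tateNormalForm` over the henselian `ℤ_[p]` and
  `LocalIndex.index_eq_of_tateNormalForm`, exactly as in
  `index_goodReductionSubgroup_eq_of_hasSplitMultiplicativeReduction`,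
  `KodairaNeronSplitHenselianProofs`);
* `WeierstrassCurve.exists_tateNormalForm_adicCompletion_of_hasSplitMultiplicativeReductionAtPrime`
  — the same Tate normal form transported along Mathlib's
  `Rat.HeightOneSpectrum.adicCompletionIntegers.padicIntEquiv v : 𝓞_v ≃ ℤ_[p]` and
  `adicCompletion.padicEquiv v : ℚ_v ≃ ℚ_[p]` (`p = primesEquiv v`): a Tate normal form `J` over
  `𝓞_v` with exponent `c_p(E) ≥ 1` and a change of variables `C` over `ℚ_v` with
  `C • (E ⊗ ℚ_v) = J ⊗ ℚ_v` (`baseChange_map_ringEquiv`, `TamagawaRingEquivProofs`; the ring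
  homomorphism `ℚ → ℚ_[p]` is unique).

## References

* [SilvermanATAEC1994] J. H. Silverman, *Advanced Topics in the Arithmetic of Elliptic Curves*
  (1994), Cor. IV.9.2(d) (PDF p. 340), V.3 (the Tate curve).
* [SilvermanAEC2009] J. H. Silverman, *The Arithmetic of Elliptic Curves*, 2nd ed. (2009),
  VII.1 Prop. 1.3, VII.6 (`c_v`), Ex. 7.6.
* [Matsuno2009] K. Matsuno, Math. Res. Lett. 16 (2009), Lemma 4.1 (hypotheses (i), (iii)).

## Design

No definitions; theorems only; `open scoped Classical`.  Deliberate dot-notation extension of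
Mathlib's `WeierstrassCurve` namespace.  `ℤ_[p]` is henselian through Mathlib's
`IsAdicComplete (maximalIdeal ℤ_[p]) ℤ_[p]` and `IsAdicComplete.henselianRing`.
-/

noncomputable section

open scoped Classical

namespace WeierstrassCurve

open Literature.NumberTheory.EllipticCurves Literature.NumberTheory.EllipticCurves.LocalIndex
  IsLocalRing Polynomial IsDiscreteValuationRing IsDedekindDomain.HeightOneSpectrum

/-! ## Over `ℤ_[p]`: the Tate normal form with exponent `c_p` -/

set_option maxHeartbeats 800000 in
/-- **The Tate normal form of `E/ℚ` at a prime `p` of split multiplicative reduction, over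
`ℤ_[p]`, with exponent `c_p(E)`.**  If `E` has split multiplicative reduction at `p`
(`HasSplitMultiplicativeReductionAtPrime`: the `ℤ_[p]`-minimal model of `E ⊗ ℚ_[p]` has split
multiplicative reduction), there are a Weierstrass equation `J` over `ℤ_[p]` in Tate normal form
`y² + xy = x³ + απᶜ` (`α ∈ ℤ_[p]ˣ`, `π` a uniformiser, `c ≥ 1`) and a change of variables `C`
over `ℚ_[p]` with `C • (E ⊗ ℚ_[p]) = J ⊗ ℚ_[p]`, where `c` is the local Tamagawa number
`c_p(E) = [E(ℚ_p) : E₀(ℚ_p)]` (Silverman, *ATAEC*, Cor. IV.9.2(d): for split multiplicative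
reduction `E(K)/E₀(K)` is cyclic of order `v(Δ)`; the Tate normal form is
`WeierstrassCurve.exists_variableChange_eq_tateNormalForm` over the henselian `ℤ_[p]`, its index is
`LocalIndex.index_eq_of_tateNormalForm`).
[cite: SilvermanATAEC1994, Cor. IV.9.2(d) (PDF p. 340)] -/
theorem exists_tateNormalForm_padic (E : WeierstrassCurve ℚ) [E.IsElliptic] (p : ℕ) [Fact p.Prime]
    (hsplit : E.HasSplitMultiplicativeReductionAtPrime p) :
    ∃ (J : WeierstrassCurve ℤ_[p]) (ϖ α : ℤ_[p]) (C : VariableChange ℚ_[p]),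
      Irreducible ϖ ∧ IsUnit α ∧ J.a₁ = 1 ∧ J.a₂ = 0 ∧ J.a₃ = 0 ∧ J.a₄ = 0 ∧
      1 ≤ (E.baseChange ℚ_[p]).localTamagawaNumber ℤ_[p] ∧
      J.a₆ = α * ϖ ^ (E.baseChange ℚ_[p]).localTamagawaNumber ℤ_[p] ∧
      C • E.baseChange ℚ_[p] = J.baseChange ℚ_[p] := by
  -- `ℤ_[p]` is a henselian local ring
  haveI : HenselianLocalRing ℤ_[p] :=
    { is_henselian := fun f hf a₀ h₁ h₂ =>
        HenselianRing.is_henselian (I := IsLocalRing.maximalIdeal ℤ_[p]) f hf a₀ h₁ (h₂.map _) }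
  haveI : (E.baseChange ℚ_[p]).IsElliptic := by unfold baseChange; infer_instance
  set W := E.baseChange ℚ_[p] with hW
  -- the minimal model and an integral model `I₀` of it
  obtain ⟨C₀, hC₀⟩ : ∃ C : VariableChange ℚ_[p], W.minimal ℤ_[p] = C • W := ⟨_, rfl⟩
  have hsm : (W.minimal ℤ_[p]).HasSplitMultiplicativeReduction ℤ_[p] := hsplit
  obtain ⟨I₀, hI₀⟩ : ∃ I₀ : WeierstrassCurve ℤ_[p], W.minimal ℤ_[p] = I₀.baseChange ℚ_[p] :=
    IsIntegral.integral
  haveI hsm' : (I₀.baseChange ℚ_[p]).HasSplitMultiplicativeReduction ℤ_[p] := hI₀ ▸ hsm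
  haveI hWe : (W.minimal ℤ_[p]).IsElliptic := by rw [hC₀]; infer_instance
  haveI : (I₀.baseChange ℚ_[p]).IsElliptic := hI₀ ▸ hWe
  have hIm : (I₀.baseChange ℚ_[p]).integralModel ℤ_[p] = I₀ := integralModel_baseChange_eq ℤ_[p] I₀
  -- hypotheses of the normal form theorem
  have hΔm : I₀.Δ ∈ IsLocalRing.maximalIdeal ℤ_[p] := by
    have h := hsm'.badReduction
    rw [← integralModel_Δ_eq ℤ_[p] (I₀.baseChange ℚ_[p]), hIm] at h
    exact (valuation_lt_one_iff_mem _ _).mp h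
  have hc₄m : I₀.c₄ ∉ IsLocalRing.maximalIdeal ℤ_[p] := by
    have h := hsm'.multiplicativeReduction
    rw [← integralModel_c₄_eq ℤ_[p] (I₀.baseChange ℚ_[p]), hIm, valuation_of_algebraMap] at h
    exact intValuation_eq_one_iff.mp h
  have hsplit' : ∃ μ : IsLocalRing.ResidueField ℤ_[p], letI Ib := I₀.map (IsLocalRing.residue ℤ_[p]);
      Ib.c₄ * μ ^ 2 + Ib.a₁ * Ib.c₄ * μ - (54 * Ib.b₆ - 3 * Ib.b₂ * Ib.b₄ + Ib.a₂ * Ib.c₄) = 0 := by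
    have hs := hsm'.splitMultiplicativeReduction
    rw [hIm] at hs
    have hc₄b : IsLocalRing.residue ℤ_[p] I₀.c₄ ≠ 0 := by
      rw [Ne, IsLocalRing.residue_eq_zero_iff]; exact hc₄m
    have hdeg : degree (Polynomial.map (algebraMap ℤ_[p] (IsLocalRing.ResidueField ℤ_[p]))
        (C I₀.c₄ * X ^ 2 + C (I₀.a₁ * I₀.c₄) * X
          - C (54 * I₀.b₆ - 3 * I₀.b₂ * I₀.b₄ + I₀.a₂ * I₀.c₄))) ≠ 0 := by
      rw [Polynomial.map_sub, Polynomial.map_add, Polynomial.map_mul, Polynomial.map_mul,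
        Polynomial.map_pow, map_C, map_C, map_C, Polynomial.map_X, sub_eq_add_neg, ← C_neg,
        IsLocalRing.ResidueField.algebraMap_eq, degree_quadratic hc₄b]
      decide
    obtain ⟨μ, hμ⟩ := hs.exists_eval_eq_zero hdeg
    refine ⟨μ, ?_⟩
    rw [eval_map, IsLocalRing.ResidueField.algebraMap_eq] at hμ
    simp only [eval₂_sub, eval₂_add, eval₂_mul, eval₂_C, eval₂_X, eval₂_pow, eval₂_ofNat,
      map_mul, map_sub, map_add, map_ofNat] at hμ
    simp only [map_c₄, map_a₁, map_a₂, map_b₂, map_b₄, map_b₆]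
    exact hμ
  -- Tate normal form `J = D • I₀ : y² + xy = x³ + a₆`, `a₆ = α ϖⁿ`, `n ≥ 1`
  obtain ⟨D, h1, h2, h3, h4, h6⟩ := I₀.exists_variableChange_eq_tateNormalForm hΔm hc₄m hsplit'
  set J := D • I₀ with hJ
  obtain ⟨ϖ, hϖ⟩ := IsDiscreteValuationRing.exists_irreducible ℤ_[p]
  have hI₀Δ : I₀.Δ ≠ 0 := by
    intro h0
    apply (I₀.baseChange ℚ_[p]).isUnit_Δ.ne_zero
    change (I₀.map (algebraMap ℤ_[p] ℚ_[p])).Δ = 0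
    rw [map_Δ, h0, map_zero]
  have hJΔ : J.Δ = -(J.a₆ * (1 + 432 * J.a₆)) := Δ_eq_of_tateNormalForm _ h1 h2 h3 h4
  have hJΔ' : J.Δ = ((D.u⁻¹ : ℤ_[p]ˣ) : ℤ_[p]) ^ 12 * I₀.Δ := variableChange_Δ _ _
  have ha0 : J.a₆ ≠ 0 := by
    intro h0
    apply hI₀Δ
    have e : ((D.u⁻¹ : ℤ_[p]ˣ) : ℤ_[p]) ^ 12 * I₀.Δ = 0 := by rw [← hJΔ', hJΔ, h0, zero_mul, neg_zero]
    exact ((D.u⁻¹.isUnit.pow 12).mul_right_eq_zero).mp e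
  obtain ⟨n, α, hα⟩ := IsDiscreteValuationRing.eq_unit_mul_pow_irreducible ha0 hϖ
  have hn1 : 1 ≤ n := by
    rcases Nat.eq_zero_or_pos n with h0 | hpos
    · exfalso
      rw [h0, pow_zero, mul_one] at hα
      rw [hα] at h6
      exact (IsLocalRing.mem_maximalIdeal _).mp h6 α.isUnit
    · exact hpos
  -- the index `[E(ℚ_p) : E₀(ℚ_p)] = n`, i.e. `c_p(E) = n`
  have hindex : ((I₀.baseChange ℚ_[p]).goodReductionSubgroup ℤ_[p]).index = n := by
    rw [goodReductionSubgroup_baseChange_eq, ← index_nonsingularReductionSubgroup_smul I₀ D]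
    exact index_eq_of_tateNormalForm (K := ℚ_[p]) J hϖ h1 h2 h3 h4 α.isUnit hn1 hα
  have htam : W.localTamagawaNumber ℤ_[p] = n := by
    rw [← hindex]
    change ((W.minimal ℤ_[p]).goodReductionSubgroup ℤ_[p]).index = _
    exact index_goodReductionSubgroup_congr_of_eq hI₀
  -- the change of variables over `ℚ_[p]`
  refine ⟨J, ϖ, α, D.map (algebraMap ℤ_[p] ℚ_[p]) * C₀, hϖ, α.isUnit, h1, h2, h3,
    h4, by rw [htam]; exact hn1, by rw [htam]; exact hα, ?_⟩
  rw [mul_smul, ← hC₀, hI₀, hJ]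
  change _ = (D • I₀).map (algebraMap ℤ_[p] ℚ_[p])
  rw [← map_variableChange]
  rfl

/-! ## Over `𝓞_v ⊆ ℚ_v`: transport along `padicIntEquiv`, `padicEquiv` -/

open IsDedekindDomain NumberField Rat.HeightOneSpectrum in
set_option maxHeartbeats 800000 in
/-- **The Tate normal form over the tree's completion `𝓞_v ⊆ ℚ_v`.**  For an elliptic curve
`E/ℚ` with split multiplicative reduction at the prime `p` under the finite place `v` of `ℚ`
(`primesEquiv v = p`): there are a Tate normal form `J : y² + xy = x³ + απᶜ` over
`𝓞_v = v.adicCompletionIntegers ℚ` (`α` a unit, `π` a uniformiser) with exponent the local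
Tamagawa number `c = c_p(E) ≥ 1` and a change of variables `C` over `ℚ_v` with
`C • (E ⊗ ℚ_v) = J ⊗ ℚ_v` — the `ℤ_[p]`-statement `exists_tateNormalForm_padic` transported along
Mathlib's `padicIntEquiv v : 𝓞_v ≃ ℤ_[p]`, `padicEquiv v : ℚ_v ≃ ℚ_[p]`.
[cite: SilvermanATAEC1994, Cor. IV.9.2(d) (PDF p. 340)] -/
theorem exists_tateNormalForm_adicCompletion_of_hasSplitMultiplicativeReductionAtPrime
    (E : WeierstrassCurve ℚ) [E.IsElliptic] (v : HeightOneSpectrum (𝓞 ℚ)) (p : ℕ) [Fact p.Prime]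
    (hv : (primesEquiv v : ℕ) = p) (hsplit : E.HasSplitMultiplicativeReductionAtPrime p) :
    ∃ (J : WeierstrassCurve (v.adicCompletionIntegers ℚ)) (ϖ α : v.adicCompletionIntegers ℚ)
      (C : VariableChange (v.adicCompletion ℚ)),
      Irreducible ϖ ∧ IsUnit α ∧ J.a₁ = 1 ∧ J.a₂ = 0 ∧ J.a₃ = 0 ∧ J.a₄ = 0 ∧
      1 ≤ (E.baseChange ℚ_[p]).localTamagawaNumber ℤ_[p] ∧
      J.a₆ = α * ϖ ^ (E.baseChange ℚ_[p]).localTamagawaNumber ℤ_[p] ∧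
      C • E.baseChange (v.adicCompletion ℚ) = J.baseChange (v.adicCompletion ℚ) := by
  subst hv
  obtain ⟨J, ϖ, α, C, hϖ, hα, h1, h2, h3, h4, hc1, h6, hCE⟩ := exists_tateNormalForm_padic E _ hsplit
  set ψ : ℤ_[(primesEquiv v : ℕ)] ≃+* v.adicCompletionIntegers ℚ :=
    (adicCompletionIntegers.padicIntEquiv v).toRingEquiv.symm with hψ
  set φ : ℚ_[(primesEquiv v : ℕ)] ≃+* v.adicCompletion ℚ :=
    (adicCompletion.padicEquiv v).toRingEquiv.symm with hφ
  have hc : ∀ r : ℤ_[(primesEquiv v : ℕ)],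
      φ (algebraMap _ ℚ_[(primesEquiv v : ℕ)] r) = algebraMap _ (v.adicCompletion ℚ) (ψ r) := by
    intro r
    rw [hφ, hψ, RingEquiv.symm_apply_eq]
    change algebraMap _ _ r = (adicCompletion.padicEquiv v).toRingEquiv
      (algebraMap _ (v.adicCompletion ℚ) ((adicCompletionIntegers.padicIntEquiv v).toRingEquiv.symm r))
    have e : (adicCompletion.padicEquiv v).toRingEquiv (algebraMap _ (v.adicCompletion ℚ)
        ((adicCompletionIntegers.padicIntEquiv v).toRingEquiv.symm r)) =
        algebraMap ℤ_[(primesEquiv v : ℕ)] ℚ_[(primesEquiv v : ℕ)]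
          ((adicCompletionIntegers.padicIntEquiv v).toRingEquiv
            ((adicCompletionIntegers.padicIntEquiv v).toRingEquiv.symm r)) := rfl
    rw [e, RingEquiv.apply_symm_apply]
  refine ⟨J.map (ψ : ℤ_[(primesEquiv v : ℕ)] →+* v.adicCompletionIntegers ℚ), ψ ϖ, ψ α,
    C.map (φ : ℚ_[(primesEquiv v : ℕ)] →+* v.adicCompletion ℚ), ?_, hα.map ψ,
    by rw [map_a₁, h1, map_one], by rw [map_a₂, h2, map_zero], by rw [map_a₃, h3, map_zero],
    by rw [map_a₄, h4, map_zero], hc1, by rw [map_a₆, h6, map_mul, map_pow]; rfl, ?_⟩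
  · exact (MulEquiv.irreducible_iff ψ).mpr hϖ
  · -- `(C • E ⊗ ℚ_[p]).map φ = C.map φ • E ⊗ ℚ_v` and `(J ⊗ ℚ_[p]).map φ = (ψ J) ⊗ ℚ_v`
    have hE : (E.baseChange ℚ_[(primesEquiv v : ℕ)]).map
        (φ : ℚ_[(primesEquiv v : ℕ)] →+* v.adicCompletion ℚ) = E.baseChange (v.adicCompletion ℚ) := by
      rw [baseChange, baseChange, map_map]
      congr 1
      exact Subsingleton.elim _ _
    rw [← hE, map_variableChange, hCE]
    exact baseChange_map_ringEquiv ψ φ hc J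

end WeierstrassCurve

end
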